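import Literature.RingTheory.MvPolynomial.HomogeneousSopRegularSequence
import Literature.RingTheory.MvPolynomial.WeightedHomogeneousSopCount
import HarnessLib

/-!
# A WEIGHTED homogeneous system of parameters of `K[x₁, …, x_k]` is a regular sequence
# (Matsumura, Thm. 17.4 (iii); the «regular sequence `∂f/∂x_1, …, ∂f/∂x_r`» of Yerly-Soler's algebraic proof of Milnor–Orlik)

Topic `Literature/RingTheory/MvPolynomial`. The weighted companion of the tree's
`Literature.RingTheory.MvPolynomial.HomogeneousSopRegularSequence` (standard grading), by the same route: in the regular local
ring `K[x]_𝔪` (`𝔪 = (x₁, …, x_k)`) of dimension `k` the images of `g₁, …, g_k` are a system of parameters, hence a regular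
sequence (the tree's `RegularLocalRing.SopRegular.isRegular_of_maximalIdeal_pow_le_ofList`, Matsumura Thm. 17.4 (iii) with
17.8); regularity descends to `K[x]` because the prefix ideals `(g₁, …, g_{i−1})` are `w`-HOMOGENEOUS for POSITIVE weights `w`:
if `s · f ∈ I` with `I` `w`-homogeneous and `s(0) ≠ 0` then `f ∈ I` (weighted graded descent, § 1 — the one place where the
weights enter: the weight-`0` piece of `K[x]` is `K` exactly when every `w_i > 0`).

## Sources (as printed)

* H. Matsumura, *Commutative Ring Theory* (CUP 1986) [Matsumura1987], Thm. 17.4: «Let `(A, 𝔪)` be a CM local ring. … (iii)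
  … `a_1, …, a_r` is an `A`-sequence ⟺ `dim A/(a_1, …, a_i) = dim A − i` for `1 ≤ i ≤ r` … hence every system of parameters
  of a CM local ring is an `A`-sequence»; Thm. 17.8 (regular ⇒ CM); Thm. 16.5 (i) (Koszul homology of a regular sequence)
  — cited as in the tree's standard-graded file.
* Y. Soler, *An algebraic proof of the Milnor–Orlik theorem*, Beitr. Algebra Geom. (2026), arXiv:2605.21703 [Soler2026] (held),
  § 1: «For a polynomial defining a hypersurface with an isolated singularity, we use the fact that its first-order partial
  derivatives form a regular sequence. Consequently, the Koszul complex gives a free resolution of the Milnor algebra.»; § 3: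
  «Since `f` defines an isolated hypersurface singularity, `f_1, …, f_r` is a regular sequence.» — § 3 below is that fact for a
  weighted homogeneous `f` (the route which `Literature.AlgebraicGeometry.Deformation.MilnorOrlikFormula` records as «not
  re-typed»).
* F. Catanese, C. Ciliberto, C. Galati, arXiv:2604.14729 [CataneseCilibertoGalati2026], § 4: «If `f` is quasi-homogeneous of
  isobaric type `(w_1, …, w_n; m)` … we say again that `f` is regular if the partial derivatives form a regular sequence.»

## Dictionary and what is here (theorems only — no `def`, no instance, no notation, no named fact; net debt 0)

`K` any field, `S = MvPolynomial (Fin k) K`, weights `w : Fin k → ℕ` with all `w_i ≠ 0`, `g : Fin k → S` with `g_i`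
`w`-weighted homogeneous of weighted degree `e_i ≠ 0` (`IsWeightedHomogeneous w (g i) (e i)`), and «system of parameters»
spelled `hX : ∀ i, ∃ n, X i ^ n ∈ (g)` (⟺ `dim_K S/(g) < ∞`, tree `WeightedHomogeneousSopCount.exists_X_pow_mem_of_moduleFinite_quotient`);
«regular sequence» = Mathlib `RingTheory.Sequence.IsWeaklyRegular S (List.ofFn g)` (on the ring itself weakly regular =
regular up to `S/(g) ≠ 0`, which holds); `H₁(g; S) = 0` = the tree's `Koszul.HasKoszulSyzygies g`.

* § 1 weighted graded descent: **`mem_of_mul_mem_of_constantCoeff_ne_zero_of_isHomogeneous`** (`I` `w`-homogeneous, all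
  `w_i ≠ 0`, `s(0) ≠ 0`, `s f ∈ I` ⟹ `f ∈ I`).
* § 2 **`isWeaklyRegular_of_isWeightedHomogeneous_of_X_pow_mem_span`** (Matsumura 17.4 (iii), weighted graded form),
  `…_of_moduleFinite`, **`hasKoszulSyzygies_of_isWeightedHomogeneous_of_X_pow_mem_span`** (`H₁ = 0`).
* § 3 the gradient: **`isWeaklyRegular_pderiv_of_isWeightedHomogeneous`** — for `f` of type `(w; d)` with `0 < w_i < d` and
  `dim_K S/(∂f) < ∞`, `∂f/∂x_0, …, ∂f/∂x_{k−1}` is a regular sequence [Soler2026, § 3]; `hasKoszulSyzygies_pderiv_of_isWeightedHomogeneous`.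

HONEST SCOPE. Weak regularity on `S` (Mathlib's `IsWeaklyRegular`); the Koszul COMPLEX / free resolution of [Soler2026] is not
re-typed beyond `H₁ = 0` (the tree's `Koszul` files stop at first homology). `σ = Fin k` (as many generators as variables).

Cell `pub-hsemireg`, lineage hsemireg-lit-8 (g25), 2026-09-02. Theorems only; net debt 0.
-/

noncomputable section

open MvPolynomial IsLocalRing RingTheory.Sequence

namespace Literature.RingTheory.MvPolynomial.WeightedHomogeneousSopRegularSequence

open Literature.RingTheory.MvPolynomial (idealDegree idealDegree_eq_of_X_pow_mem mem_idealDegree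
  weightedHomogeneousComponent_mem_of_mem_span)
open Literature.RingTheory.MvPolynomial.WeightedHomogeneousSopCount (exists_X_pow_mem_of_moduleFinite_quotient)

universe u

variable {K : Type u} [Field K]

/-! ### § 1 Weighted graded descent: `s · f ∈ I`, `I` `w`-homogeneous, `s(0) ≠ 0` ⟹ `f ∈ I` -/

section Descent

variable {σ : Type*} {w : σ → ℕ} (hw : ∀ i, w i ≠ 0)
include hw

/-- For positive weights, a monomial of weight `0` is the constant monomial. [folklore] -/
private theorem eq_zero_of_weight_eq_zero {d : σ →₀ ℕ} (hd : Finsupp.weight w d = 0) : d = 0 := by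
  classical
  rw [Finsupp.weight_apply, Finsupp.sum, Finset.sum_eq_zero_iff] at hd
  ext i
  rw [Finsupp.coe_zero, Pi.zero_apply]
  by_contra hi
  have h := hd i (Finsupp.mem_support_iff.mpr hi)
  rw [smul_eq_mul, mul_eq_zero] at h
  exact h.elim hi (hw i)

/-- If all coefficients of `g` of weight `< n` vanish, then the weight-`n` component of `s · g` is `s(0) · g_n`
(positive weights). [folklore] -/
private theorem weightedHomogeneousComponent_mul_of_coeff_eq_zero [DecidableEq σ] {s g : MvPolynomial σ K} {n : ℕ}
    (hg : ∀ d : σ →₀ ℕ, Finsupp.weight w d < n → coeff d g = 0) :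
    weightedHomogeneousComponent w n (s * g) = C (coeff 0 s) * weightedHomogeneousComponent w n g := by
  classical
  ext d
  rw [coeff_weightedHomogeneousComponent, coeff_C_mul, coeff_weightedHomogeneousComponent]
  split_ifs with hdn
  · rw [coeff_mul, Finset.sum_eq_single (0, d)]
    · rintro ⟨d₁, d₂⟩ hmem hne
      rw [Finset.mem_antidiagonal] at hmem
      -- either `d₁ ≠ 0`, so `weight d₂ < n` and `coeff d₂ g = 0`
      by_cases h₁ : d₁ = 0
      · subst h₁
        simp only [zero_add] at hmem
        exact absurd (show ((0 : σ →₀ ℕ), d₂) = (0, d) by rw [hmem]) hne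
      · have hw₁ : Finsupp.weight w d₁ ≠ 0 := fun h => h₁ (eq_zero_of_weight_eq_zero hw h)
        have hsum : Finsupp.weight w d₁ + Finsupp.weight w d₂ = n := by rw [← map_add, hmem, hdn]
        rw [hg d₂ (by omega), mul_zero]
    · intro h
      exact absurd (Finset.mem_antidiagonal.mpr (zero_add d)) h
  · rw [mul_zero]

/-- **Weighted graded descent.** Let all weights be positive and let `I ⊆ K[x]` be a `w`-homogeneous ideal, i.e. closed under
taking weighted homogeneous components (so phrased to avoid a graded-ring instance in the statement). If `s` has non-zero constant term and `s · f ∈ I`, then `f ∈ I` (induction on the weight: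
`s(0) · f_n = (s · (f − Σ_{m<n} f_m))_n ∈ I`). This is how regularity in `K[x]_𝔪` descends to `K[x]` for weighted homogeneous
ideals. [cite: Matsumura1987, Thm. 17.4 (iii) (graded case)] -/
theorem mem_of_mul_mem_of_constantCoeff_ne_zero_of_isHomogeneous {I : Ideal (MvPolynomial σ K)}
    (hI : ∀ p ∈ I, ∀ n : ℕ, weightedHomogeneousComponent w n p ∈ I) {s f : MvPolynomial σ K}
    (hs : constantCoeff s ≠ 0) (h : s * f ∈ I) : f ∈ I := by
  classical
  suffices hcomp : ∀ n, weightedHomogeneousComponent w n f ∈ I by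
    rw [← sum_weightedHomogeneousComponent w f, finsum_eq_sum _ (weightedHomogeneousComponent_finsupp f)]
    exact Ideal.sum_mem _ fun n _ => hcomp n
  intro n
  induction n using Nat.strong_induction_on with
  | _ n ih =>
    -- remove the components below `n`
    set g : MvPolynomial σ K := f - ∑ m ∈ Finset.range n, weightedHomogeneousComponent w m f with hg
    have hsg : s * g ∈ I := by
      rw [hg, mul_sub, Finset.mul_sum]
      exact I.sub_mem h (I.sum_mem fun m hm => I.mul_mem_left _ (ih m (Finset.mem_range.mp hm)))
    have hgcoeff : ∀ d : σ →₀ ℕ, Finsupp.weight w d < n → coeff d g = 0 := by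
      intro d hd
      rw [hg, coeff_sub, coeff_sum, Finset.sum_eq_single (Finsupp.weight w d)]
      · rw [coeff_weightedHomogeneousComponent, if_pos rfl, sub_self]
      · intro m _ hm
        rw [coeff_weightedHomogeneousComponent, if_neg (Ne.symm hm)]
      · intro hd'
        exact absurd (Finset.mem_range.mpr hd) hd'
    have hgn : weightedHomogeneousComponent w n g = weightedHomogeneousComponent w n f := by
      rw [hg, map_sub, map_sum, Finset.sum_eq_zero, sub_zero]
      intro m hm
      rw [weightedHomogeneousComponent_of_mem (weightedHomogeneousComponent_mem w f m),
        if_neg (Finset.mem_range.mp hm).ne']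
    -- `s(0) · f_n = (s g)_n ∈ I`
    have hn : weightedHomogeneousComponent w n (s * g) ∈ I := hI _ hsg n
    rw [weightedHomogeneousComponent_mul_of_coeff_eq_zero hw hgcoeff, hgn] at hn
    have hc : coeff 0 s ≠ 0 := by rwa [constantCoeff_eq] at hs
    have : weightedHomogeneousComponent w n f =
        C (coeff 0 s)⁻¹ * (C (coeff 0 s) * weightedHomogeneousComponent w n f) := by
      rw [← mul_assoc, ← C_mul, inv_mul_cancel₀ hc, C_1, one_mul]
    rw [this]
    exact I.mul_mem_left _ hn

end Descent

/-! ### § 2 Macaulay / Matsumura 17.4 (iii), weighted graded form -/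

section Macaulay

variable {k : ℕ}

/-- Elements of `𝔪ᵀ`, `𝔪 = ker constantCoeff`, have no (standard) homogeneous components of degree `< T`
(private copy of the standard-graded file's helper). [folklore] -/
private theorem homogeneousComponent_eq_zero_of_mem_ker_constantCoeff_pow {σ : Type*} :
    ∀ (T : ℕ) {p : MvPolynomial σ K},
      p ∈ (RingHom.ker (constantCoeff : MvPolynomial σ K →+* K)) ^ T →
      ∀ t, t < T → homogeneousComponent t p = 0
  | 0, _, _, t, ht => absurd ht (Nat.not_lt_zero t)
  | T + 1, p, hp, t, ht => by
    classical
    rw [pow_succ'] at hp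
    revert t
    refine Submodule.mul_induction_on hp (fun m hm q hq => ?_) (fun x y hx hy t ht => ?_)
    · intro t ht
      have hm0 : coeff 0 m = 0 := by rw [← constantCoeff_eq]; exact (RingHom.mem_ker).1 hm
      ext d
      rw [coeff_homogeneousComponent, coeff_zero]
      split_ifs with hd
      · rw [coeff_mul]
        refine Finset.sum_eq_zero fun x hx => ?_
        rw [Finset.mem_antidiagonal] at hx
        rcases x with ⟨d₁, d₂⟩
        by_cases h₁ : d₁ = 0
        · subst h₁; rw [hm0, zero_mul]
        · -- `deg d₂ < T`, so the degree-`deg d₂` component of `q` vanishes, hence `coeff d₂ q = 0`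
          have hdeg : d₂.degree < T := by
            have h12 : d₁.degree + d₂.degree = t := by rw [← map_add, hx]; exact hd
            have hpos : 0 < d₁.degree := Nat.pos_of_ne_zero fun h0 => h₁ ((Finsupp.degree_eq_zero_iff d₁).mp h0)
            omega
          have hq0 := homogeneousComponent_eq_zero_of_mem_ker_constantCoeff_pow T hq d₂.degree hdeg
          have : coeff d₂ q = 0 := by
            have hc := congrArg (coeff d₂) hq0
            rwa [coeff_homogeneousComponent, if_pos rfl, coeff_zero] at hc
          simp only [this, mul_zero]
      · rfl
    · rw [map_add, hx t ht, hy t ht, add_zero]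

/-- If every variable has a power in `I ⊆ K[x₁, …, x_m]`, then `𝔪ᴺ ⊆ I` for some `N` (`𝔪 = (x₁, …, x_m)`; private copy of the
standard-graded file's helper, via the tree's `idealDegree_eq_of_X_pow_mem`). [folklore] -/
private theorem exists_ker_constantCoeff_pow_le_of_X_pow_mem {m : ℕ} {I : Ideal (MvPolynomial (Fin m) K)}
    (hX : ∀ i, ∃ n : ℕ, (X i : MvPolynomial (Fin m) K) ^ n ∈ I) :
    ∃ N : ℕ, (RingHom.ker (constantCoeff : MvPolynomial (Fin m) K →+* K)) ^ N ≤ I := by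
  classical
  obtain ⟨t₀, ht₀⟩ := idealDegree_eq_of_X_pow_mem hX
  refine ⟨t₀ + 1, fun p hp => ?_⟩
  rw [← sum_homogeneousComponent p]
  refine Ideal.sum_mem _ fun t _ => ?_
  by_cases ht : t < t₀ + 1
  · rw [homogeneousComponent_eq_zero_of_mem_ker_constantCoeff_pow (t₀ + 1) hp t ht]
    exact I.zero_mem
  · have hmem : homogeneousComponent t p ∈ idealDegree I t := by
      rw [ht₀ t (by omega) (by omega)]; exact homogeneousComponent_mem t p
    exact ((mem_idealDegree).1 hmem).1

/-- The ideal of the list `(g₁, …, g_k)` is the ideal generated by the range. [folklore] -/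
private theorem ofList_ofFn_eq_span_range (g : Fin k → MvPolynomial (Fin k) K) :
    Ideal.ofList (List.ofFn g) = Ideal.span (Set.range g) := by
  rw [Ideal.ofList]
  congr 1
  ext z
  simp [List.mem_ofFn']

variable {w : Fin k → ℕ} (hw : ∀ i, w i ≠ 0) (g : Fin k → MvPolynomial (Fin k) K) {e : Fin k → ℕ}
  (hg : ∀ i, (g i).IsWeightedHomogeneous w (e i)) (he : ∀ i, e i ≠ 0)
include hw hg he

/-- **Matsumura Thm. 17.4 (iii) for the weighted graded polynomial ring: a weighted homogeneous system of parameters of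
`K[x₁, …, x_k]` is a regular sequence.** If `g₁, …, g_k` are `w`-weighted homogeneous of positive weighted degrees (all
weights positive) and every variable has a power in `(g₁, …, g_k)`, then `g₁, …, g_k` is a weakly regular sequence on
`K[x₁, …, x_k]`, for every field `K`. Proof as in the tree's standard-graded file: system of parameters of the regular local
ring `K[x]_𝔪` ⇒ regular there; weighted graded descent (§ 1) for the `w`-homogeneous prefix ideals.
[cite: Matsumura1987, Thm. 17.4 (iii)] [cite: Soler2026, § 3 («`f_1, …, f_r` is a regular sequence»)] -/
theorem isWeaklyRegular_of_isWeightedHomogeneous_of_X_pow_mem_span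
    (hX : ∀ i, ∃ n : ℕ, (X i : MvPolynomial (Fin k) K) ^ n ∈ Ideal.span (Set.range g)) :
    IsWeaklyRegular (MvPolynomial (Fin k) K) (List.ofFn g) := by
  classical
  set J : Ideal (MvPolynomial (Fin k) K) := Ideal.span (Set.range g) with hJ_def
  set 𝔪 : Ideal (MvPolynomial (Fin k) K) :=
    RingHom.ker (constantCoeff : MvPolynomial (Fin k) K →+* K) with h𝔪_def
  haveI hmax : 𝔪.IsMaximal := isMaximal_ker_constantCoeff
  have hgm : ∀ i, g i ∈ 𝔪 := by
    intro i
    rw [h𝔪_def, RingHom.mem_ker, constantCoeff_eq]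
    refine (hg i).coeff_eq_zero 0 ?_
    rw [map_zero]
    exact (he i).symm
  -- `𝔪ᴺ ⊆ J`
  obtain ⟨N, hN⟩ := exists_ker_constantCoeff_pow_le_of_X_pow_mem hX
  -- the regular local ring `R = K[x]_𝔪` of dimension `k`
  let R := Localization.AtPrime 𝔪
  let φ : MvPolynomial (Fin k) K →+* R := algebraMap _ R
  have hφm : ∀ i, φ (g i) ∈ maximalIdeal R := by
    intro i
    rw [← Localization.AtPrime.map_eq_maximalIdeal]
    exact Ideal.mem_map_of_mem _ (hgm i)
  have hdim : ringKrullDim R = (k : WithBot ℕ∞) := by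
    rw [IsLocalization.AtPrime.ringKrullDim_eq_height 𝔪 R, h𝔪_def,
      Literature.RingTheory.KrullDimension.height_ker_constantCoeff]
    rfl
  set L : List (MvPolynomial (Fin k) K) := List.ofFn g with hL_def
  have hQm : ∀ q ∈ L.map φ, q ∈ maximalIdeal R := by
    intro q hq
    rw [List.mem_map] at hq
    obtain ⟨r, hr, rfl⟩ := hq
    rw [hL_def, List.mem_ofFn'] at hr
    obtain ⟨i, rfl⟩ := hr
    exact hφm i
  have hlen : ((L.map φ).length : WithBot ℕ∞) = ringKrullDim R := by
    rw [List.length_map, hL_def, List.length_ofFn, hdim]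
  have hJL : Ideal.ofList L = J := by rw [hL_def, ofList_ofFn_eq_span_range]
  have hNloc : maximalIdeal R ^ N ≤ Ideal.ofList (L.map φ) := by
    rw [← Localization.AtPrime.map_eq_maximalIdeal, ← Ideal.map_pow, ← Ideal.map_ofList, hJL]
    exact Ideal.map_mono hN
  have hreg : IsWeaklyRegular R (L.map φ) :=
    (Literature.RingTheory.RegularLocalRing.isRegular_of_maximalIdeal_pow_le_ofList
      hQm hlen hNloc).toIsWeaklyRegular
  -- descend to `K[x]`, prefix by prefix
  refine (isWeaklyRegular_iff_Fin _ _).2 fun i => ?_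
  refine (isSMulRegular_quotient_iff_mem_of_smul_mem _ _).2 fun f hf => ?_
  set P : Ideal (MvPolynomial (Fin k) K) := Ideal.ofList (L.take i) with hP_def
  have hPtop : (Ideal.ofList (L.take i) • ⊤ : Submodule (MvPolynomial (Fin k) K)
      (MvPolynomial (Fin k) K)) = Submodule.restrictScalars _ P := by
    rw [Ideal.smul_eq_mul, Ideal.mul_top]
    rfl
  rw [hPtop, Submodule.restrictScalars_mem] at hf ⊢
  rw [smul_eq_mul] at hf
  -- the prefix ideal is `w`-homogeneous (closed under weighted components)
  have hPhom : ∀ p ∈ P, ∀ n : ℕ, weightedHomogeneousComponent w n p ∈ P := by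
    intro p hp n
    rw [hP_def, Ideal.ofList] at hp ⊢
    refine weightedHomogeneousComponent_mem_of_mem_span w (fun r hr => ?_) hp n
    have hr' : r ∈ L := List.mem_of_mem_take hr
    rw [hL_def, List.mem_ofFn'] at hr'
    obtain ⟨j, rfl⟩ := hr'
    exact ⟨e j, hg j⟩
  have hLi : L[(i : ℕ)] = g ⟨i, by simpa [hL_def] using i.2⟩ := by
    simp [hL_def, List.getElem_ofFn]
  simp only [Fin.getElem_fin] at hf
  rw [hLi] at hf
  -- regularity in `R` at position `i`
  have hiR : (i : ℕ) < (L.map φ).length := by rw [List.length_map]; exact i.2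
  have hregi := (isWeaklyRegular_iff_Fin _ _).1 hreg ⟨i, hiR⟩
  have hLφi : (L.map φ)[(i : ℕ)] = φ (g ⟨i, by simpa [hL_def] using i.2⟩) := by
    rw [List.getElem_map, hLi]
  simp only [Fin.getElem_fin] at hregi
  rw [hLφi, ← List.map_take, ← Ideal.map_ofList] at hregi
  have h1 : φ f ∈ (P.map φ • ⊤ : Submodule R R) := by
    refine mem_of_isSMulRegular_quotient_of_smul_mem hregi ?_
    rw [Ideal.smul_eq_mul, Ideal.mul_top, smul_eq_mul, ← map_mul]
    exact Ideal.mem_map_of_mem _ hf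
  rw [Ideal.smul_eq_mul, Ideal.mul_top] at h1
  -- pull back with a denominator outside `𝔪`
  obtain ⟨⟨⟨a, ha⟩, ⟨s, hs⟩⟩, has⟩ :=
    (IsLocalization.mem_map_algebraMap_iff 𝔪.primeCompl R).1 h1
  simp only at has
  rw [← map_mul] at has
  obtain ⟨⟨c, hc⟩, hcas⟩ := (IsLocalization.eq_iff_exists 𝔪.primeCompl R).1 has
  simp only at hcas
  have hcs : constantCoeff (c * s) ≠ 0 := by
    rw [map_mul]
    exact mul_ne_zero (fun h0 => hc ((RingHom.mem_ker).2 h0)) (fun h0 => hs ((RingHom.mem_ker).2 h0))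
  refine mem_of_mul_mem_of_constantCoeff_ne_zero_of_isHomogeneous hw hPhom hcs ?_
  have : c * s * f = c * (f * s) := by ring
  rw [this, hcas]
  exact Ideal.mul_mem_left _ _ ha

/-- The same under `dim_K K[x]/(g) < ∞`. [cite: Matsumura1987, Thm. 17.4 (iii)] [cite: Soler2026, § 3] -/
theorem isWeaklyRegular_of_isWeightedHomogeneous_of_moduleFinite
    [Module.Finite K (MvPolynomial (Fin k) K ⧸ Ideal.span (Set.range g))] :
    IsWeaklyRegular (MvPolynomial (Fin k) K) (List.ofFn g) :=
  isWeaklyRegular_of_isWeightedHomogeneous_of_X_pow_mem_span hw g hg he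
    (exists_X_pow_mem_of_moduleFinite_quotient hw (by rintro _ ⟨i, rfl⟩; exact ⟨e i, hg i⟩))

/-- **`H₁(g; K[x]) = 0` for a weighted homogeneous system of parameters** (Matsumura Thm. 16.5 (i) on top of 17.4 (iii)):
every relation `Σ cᵢ gᵢ = 0` is a combination of the trivial ones `gᵢ eⱼ − gⱼ eᵢ` («the Koszul complex is an exact sequence»,
degree 1). [cite: Matsumura1987, Thm. 16.5 (i)] [cite: Soler2026, § 3] -/
theorem hasKoszulSyzygies_of_isWeightedHomogeneous_of_X_pow_mem_span
    (hX : ∀ i, ∃ n : ℕ, (X i : MvPolynomial (Fin k) K) ^ n ∈ Ideal.span (Set.range g)) :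
    Literature.RingTheory.Koszul.HasKoszulSyzygies g :=
  Literature.RingTheory.Koszul.hasKoszulSyzygies_of_isWeaklyRegular g
    (isWeaklyRegular_of_isWeightedHomogeneous_of_X_pow_mem_span hw g hg he hX)

end Macaulay

/-! ### § 3 The partial derivatives of a weighted homogeneous polynomial with `μ < ∞` form a regular sequence -/

section Gradient

variable {k : ℕ} {w : Fin k → ℕ} {d : ℕ} {f : MvPolynomial (Fin k) K}
  (hf : f.IsWeightedHomogeneous w d) (hw : ∀ i, w i ≠ 0) (hwd : ∀ i, w i < d)
include hf hw hwd

/-- **[Soler2026, § 3]: «Since `f` defines an isolated hypersurface singularity, `f_1, …, f_r` is a regular sequence.»** For `f`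
weighted homogeneous of type `(w; d)` with `0 < w_i < d` and `dim_K K[x]/(∂f) < ∞` (as `hX`), the partial derivatives
`∂f/∂x_0, …, ∂f/∂x_{k−1}` form a (weakly) regular sequence on `K[x]`. [cite: Soler2026, § 3] [cite: Matsumura1987, Thm. 17.4 (iii)]
[cite: CataneseCilibertoGalati2026, § 4 («regular if the partial derivatives form a regular sequence»)] -/
theorem isWeaklyRegular_pderiv_of_isWeightedHomogeneous
    (hX : ∀ j, ∃ n : ℕ, (X j : MvPolynomial (Fin k) K) ^ n ∈ Ideal.span (Set.range fun i => pderiv i f)) :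
    IsWeaklyRegular (MvPolynomial (Fin k) K) (List.ofFn fun i => pderiv i f) :=
  isWeaklyRegular_of_isWeightedHomogeneous_of_X_pow_mem_span hw (fun i => pderiv i f) (e := fun i => d - w i)
    (fun i => hf.pderiv (Nat.sub_add_cancel (hwd i).le)) (fun i => Nat.sub_ne_zero_of_lt (hwd i)) hX

/-- The same under `μ(f) = dim_K K[x]/(∂f) < ∞`. [cite: Soler2026, § 3] -/
theorem isWeaklyRegular_pderiv_of_isWeightedHomogeneous_of_moduleFinite
    [Module.Finite K (MvPolynomial (Fin k) K ⧸ Ideal.span (Set.range fun i => pderiv i f))] :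
    IsWeaklyRegular (MvPolynomial (Fin k) K) (List.ofFn fun i => pderiv i f) :=
  isWeaklyRegular_of_isWeightedHomogeneous_of_moduleFinite hw (fun i => pderiv i f) (e := fun i => d - w i)
    (fun i => hf.pderiv (Nat.sub_add_cancel (hwd i).le)) (fun i => Nat.sub_ne_zero_of_lt (hwd i))

/-- `H₁(∂f; K[x]) = 0`: the syzygies of the partial derivatives of such an `f` are Koszul («the Koszul complex is an exact
sequence of graded free `S`-modules», degree 1). [cite: Soler2026, § 3] [cite: Matsumura1987, Thm. 16.5 (i)] -/
theorem hasKoszulSyzygies_pderiv_of_isWeightedHomogeneous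
    (hX : ∀ j, ∃ n : ℕ, (X j : MvPolynomial (Fin k) K) ^ n ∈ Ideal.span (Set.range fun i => pderiv i f)) :
    Literature.RingTheory.Koszul.HasKoszulSyzygies (fun i => pderiv i f) :=
  hasKoszulSyzygies_of_isWeightedHomogeneous_of_X_pow_mem_span hw (fun i => pderiv i f) (e := fun i => d - w i)
    (fun i => hf.pderiv (Nat.sub_add_cancel (hwd i).le)) (fun i => Nat.sub_ne_zero_of_lt (hwd i)) hX

end Gradient

end Literature.RingTheory.MvPolynomial.WeightedHomogeneousSopRegularSequence
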